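import Literature.MathematicalPhysics.QuantumFieldTheory.Balaban1983to89.B15Prop1SliceCoordinates
import Literature.MathematicalPhysics.QuantumFieldTheory.Balaban1983to89.B16Ineq18AxialGauge
import Literature.MathematicalPhysics.QuantumFieldTheory.Balaban1983to89.T4AxialGaugeSmallField

/-!
# `Balaban1983to89.B15Prop1SliceIneq18` — T. Bałaban, *Large field renormalization. II. Localization, exponentiation, and bounds
for the 𝐑 operation*, Commun. Math. Phys. **122** (1989) 355–392 [Balaban1989LargeFieldII] («[LF-II]»), Sect. 1 p. 358 (1.8) in the
`x₁`-axial gauge, AT THE SLICE OF RECORD: the Poincaré inequality `‖B′‖² ≤ C·Σ_p |(∂B′)(p)|²` for the gauge-fixed coordinates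
`B′ : GaugeSlice (Λ^{(k)}) (G₀) ℝ³` of the Proposition-1 chart on a parallelepiped of the torus `T^{(k)}` with print's `x₁`-axial tree
`G₀` (dag-n12-c's `B15Prop1SliceCoordinates` p468327 / `B15Prop1CarrierOnSU2Box.prop1Printed_lfVarOn_su2_box_slice` p470158) — transported
BY NAME from the `ℤ^d` theorem `B16Ineq18AxialGauge.ineq18_axial_vec` through pv26's periodic projection `T4AxialGaugeSmallField.castSite`.

statement-level skeleton of published theorems with citation tags; proofs where landed; nothing here is a claim about
the Yang–Mills mass gap

Cell pub-ymgap, HUMAN RULING D-0062 (Track A full width), seat `pub-ymgap-dag-n12-c` (R134 acceleration seat (a), strategy s1 of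
DAG node N12 = [B15]; generation g2, eighth product).  PDF held: `paper:balaban1989-cmp122-large-field-ii` (journal page = PDF page + 354;
p. 358 = PDF 4).

THE PRINT (p. 358): *«Consider the quadratic form ‖∂B′‖² on the fields B′ defined on Λ, and equal to 0 on bonds of the graph G₀. …
Σ_{b∈Λ}|B′(b)|² ≦ d(100M)^{d+1} Σ_{p∈Λ}|(∂B′)(p)|². (1.8) … For example, if in this domain Λ we fix an axial gauge in the direction of
x₁-axis, i.e., we put B′((x − e₁, x)) = 0 for x ∈ Λ, then the inequality (1.8) holds with the constant (100M)³.»*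

WHAT THIS FILE PROVES (theorems only; Mathlib + the three imports; no `sorry`, no definition, no `… : Prop` fact; axioms standard).
For `Λ^{(k)} = castSite″(box n lo)` (pv26's projection of the integer parallelepiped `{lo ≤ x < lo + n}` of `B16Eq18Proof.box`,
non-wrapping with a margin: `n_κ + 5 < sitesPerDir k`), the tree `G₀ = {⟨castSite (x − e₁), e₁⟩ : x ∈ box n lo}` (ALL `x₁`-bonds
ending in `Λ^{(k)}`) and the slice `GaugeSlice (Λ^{(k)}) G₀ ℝ³` with its extension by zero `ιA`:
§1 bookkeeping (`unitVec_eq_e`, `shift_castSite_sub`, injectivity on the window `box (n+6) (lo−3)`, `not_mem_bondsOf_of_window`,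
   `ιA_G0_eq_zero`, the windowed pullback `pullW` written inline and its agreement with the plain pullback on the window);
§2 **`sliceNormSq_le`** — `‖B′‖² ≤ (3K² + 2K⁴) · Σ_{z ∈ box (n+3)(lo−2)} Σ_μ Σ_a ((∂B′_a)(castSite z; e₁, e_μ))²` for `n₁, n₂ ≤ K`
   (`d ≥ 2`), the circulation written through the pullback `b ↦ (ιA B′) ⟨castSite b.1, b.2⟩` (by `castSite (z + e_j) =
   (castSite z).shift j` it IS the torus plaquette circulation `B′(s,j) + B′(s+e_j,μ) − B′(s+e_μ,j) − B′(s,μ)` at `s = castSite z`);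
   **`ineq19_slice_of_17`** — (1.9) at the slice, `γ₀/(2c_P)·‖B′‖² ≤ ⟨HB′, Δ₁HB′⟩` (`c_P = 3K² + 2K⁴`), FROM the (1.7) letter `γ₀·Q(B′) −
   C_err‖B′‖² ≤ ⟨HB′, Δ₁HB′⟩` (p. 357 perturbation, hypothesis) and the smallness `C_err ≤ γ₀/(2c_P)` (*«for g_k sufficiently small»*):
   the positivity letter (m1) of `B15Prop1CarrierOnSU2Box.prop1Printed_lfVarOn_su2_box_slice` at this slice modulo (1.7).

HONEST SCOPE.  (i) This is the TRANSPORT of the `ℤ^d` estimate, no new estimate: constant `3K² + 2K⁴` (print `(100M)³`, *«with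
different constants»*).  (ii) The right side is indexed by integer points of an explicit enlarged box (every plaquette with a
non-zero circulation is among them), not by *«p ∈ Λ»* literally.  (iii) (m1) = (1.9) at the slice is derived here ONLY modulo the (1.7) letter
(p. 357 perturbation around the background, `B16Ineq17Assembly`'s row) and the identification of `⟨H_{1,k}B′, Δ₁H_{1,k}B′⟩`'s
leading form with the typed `‖∂B′‖²` — displayed as `h17`, not discharged.  Count-neutral; NOT a discharge of N12; NOT summit
progress.
-/

noncomputable section

open Set Finset

namespace Literature.MathematicalPhysics.QuantumFieldTheory.Balaban1983to89.B15Prop1SliceIneq18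

open B15DeterminingSets GaugeField B15Prop1Carrier B15Prop1SliceCoordinates
open T4AxialGaugeSmallField (castSite castSite_add_e castSite_injOn_box)
open B7Prop1Explicit (e e_apply)
open B6BondElimination (unitVec unitVec_apply add_unitVec_apply)
open B6TreeGaugePoincare (curl)
open B16Eq18Proof (box mem_box)
open B16Ineq18AxialGauge (ineq18_axial_vec)

variable {P : Params} {k : ℕ} [DecidableEq (PBond P k)]

/-! ## §1 Bookkeeping: the window, the tree, the pullback -/

omit [DecidableEq (PBond P k)] in
/-- The two unit-vector notations of the cell agree. [folklore] -/
private theorem unitVec_eq_e (μ : Fin P.d) : (unitVec μ : Fin P.d → ℤ) = e μ := by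
  funext i; simp [unitVec_apply, e_apply]

omit [DecidableEq (PBond P k)] in
/-- `castSite (z + unitVec μ) = (castSite z).shift μ`. [folklore] -/
private theorem castSite_add_unitVec (z : Fin P.d → ℤ) (μ : Fin P.d) :
    (castSite (z + unitVec μ) : Site P k) = (castSite z).shift μ := by
  rw [unitVec_eq_e, castSite_add_e]

omit [DecidableEq (PBond P k)] in
/-- `castSite (x − unitVec μ)` steps to `castSite x`. [folklore] -/
private theorem shift_castSite_sub (x : Fin P.d → ℤ) (μ : Fin P.d) :
    (castSite (x - unitVec μ) : Site P k).shift μ = castSite x := by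
  rw [← castSite_add_unitVec, sub_add_cancel]

omit [DecidableEq (PBond P k)] in
/-- One lattice step on the torus is injective. [folklore] -/
private theorem shift_inj {s t : Site P k} {μ : Fin P.d} (h : s.shift μ = t.shift μ) : s = t := by
  funext κ
  have hκ := congr_fun h κ
  by_cases hκμ : κ = μ
  · subst hκμ; simpa [Site.shift] using hκ
  · simpa [Site.shift, Function.update_of_ne hκμ] using hκ

section Window

variable {lo : Fin P.d → ℤ} {n : Fin P.d → ℕ}

omit [DecidableEq (PBond P k)] in
/-- Membership in an enlarged box `box (n + c) (lo − c')` in coordinates. [folklore] -/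
private theorem mem_box_shift {c : ℕ} {c' : ℤ} {z : Fin P.d → ℤ} :
    z ∈ box (fun i => n i + c) (fun i => lo i - c') ↔ ∀ i, lo i - c' ≤ z i ∧ z i < lo i - c' + (n i + c) := by
  simp only [mem_box, Nat.cast_add]

omit [DecidableEq (PBond P k)] in
/-- Enlarged boxes are nested. [folklore] -/
private theorem mem_box_mono {c c₂ : ℕ} {c' c₂' : ℤ} (h1 : c' ≤ c₂') (h2 : (c : ℤ) + c₂' ≤ c₂ + c') {z : Fin P.d → ℤ}
    (hz : z ∈ box (fun i => n i + c) (fun i => lo i - c')) : z ∈ box (fun i => n i + c₂) (fun i => lo i - c₂') := by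
  rw [mem_box_shift] at hz ⊢
  intro i
  have := hz i
  constructor <;> linarith

omit [DecidableEq (PBond P k)] in
/-- **Injectivity of the projection on the window** `box (n+6) (lo−3)` under the non-wrapping margin `n_κ + 5 < sitesPerDir k`.
[folklore] -/
private theorem castSite_inj_window (hN : ∀ κ, (n κ : ℤ) + 5 < P.sitesPerDir k) {x x' : Fin P.d → ℤ}
    (hx : x ∈ box (fun i => n i + 6) (fun i => lo i - 3)) (hx' : x' ∈ box (fun i => n i + 6) (fun i => lo i - 3))
    (h : (castSite x : Site P k) = castSite x') : x = x' := by
  have h1 := mem_box_shift.1 hx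
  have h2 := mem_box_shift.1 hx'
  refine castSite_injOn_box (lo := fun i => lo i - 3) (hi := fun i => lo i + n i + 2) (fun κ => ?_)
    (fun i => (h1 i).1) (fun i => ?_) (fun i => (h2 i).1) (fun i => ?_) h
  · have := hN κ; linarith
  · have := (h1 i).2; push_cast at this; linarith
  · have := (h2 i).2; push_cast at this; linarith

omit [DecidableEq (PBond P k)] in
/-- Points of `Λ`, of `Λ − e_μ`, of the window `box (n+4)(lo−2)` and of its one-step translates all lie in the injectivity window. [folklore] -/
private theorem mem_window6 {z : Fin P.d → ℤ} {c : ℕ} {c' : ℤ} (hc : (c : ℤ) ≤ c' + 3) (hc' : c' ≤ 3)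
    (hz : z ∈ box (fun i => n i + c) (fun i => lo i - c')) : z ∈ box (fun i => n i + 6) (fun i => lo i - 3) :=
  mem_box_mono hc' (by push_cast; linarith) hz

omit [DecidableEq (PBond P k)] in
/-- `Λ = box n lo` is `box (n + 0) (lo − 0)`. [folklore] -/
private theorem box_eq_shift : box n lo = box (fun i => n i + 0) (fun i => lo i - 0) := by
  simp

omit [DecidableEq (PBond P k)] in
/-- A one-step translate of a window point stays in the next window. [folklore] -/
private theorem add_unitVec_mem {z : Fin P.d → ℤ} {c : ℕ} {c' : ℤ} (μ : Fin P.d)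
    (hz : z ∈ box (fun i => n i + c) (fun i => lo i - c')) : z + unitVec μ ∈ box (fun i => n i + (c + 1)) (fun i => lo i - c') := by
  rw [mem_box_shift] at hz ⊢
  intro i
  have := hz i
  rw [add_unitVec_apply]
  push_cast at this ⊢
  split_ifs <;> constructor <;> linarith

omit [DecidableEq (PBond P k)] in
/-- `x − unitVec μ` for `x ∈ Λ` lies in `box (n+1)(lo−1)`. [folklore] -/
private theorem sub_unitVec_mem {x : Fin P.d → ℤ} (μ : Fin P.d) (hx : x ∈ box n lo) :
    x - unitVec μ ∈ box (fun i => n i + 1) (fun i => lo i - 1) := by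
  rw [mem_box] at hx
  rw [mem_box_shift]
  intro i
  have := hx i
  simp only [Pi.sub_apply, unitVec_apply]
  push_cast
  split_ifs <;> constructor <;> linarith

omit [DecidableEq (PBond P k)] in
/-- **A window bond off `Λ` is off the variables**: for `z` in the window `box (n+4)(lo−2)` with `z ∉ Λ` and `z + e_μ ∉ Λ`, the torus
bond `⟨castSite z, μ⟩` does not meet `Λ^{(k)} = castSite″Λ` (injectivity on the window). [cite: Balaban1989LargeFieldII, (1.8) p.358] -/
theorem not_mem_bondsOf_of_window (hN : ∀ κ, (n κ : ℤ) + 5 < P.sitesPerDir k) {z : Fin P.d → ℤ} {μ : Fin P.d}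
    (hz : z ∈ box (fun i => n i + 4) (fun i => lo i - 2)) (h1 : z ∉ box n lo) (h2 : z + unitVec μ ∉ box n lo) :
    (⟨castSite z, μ⟩ : PBond P k) ∉ bondsOf (castSite '' (↑(box n lo) : Set (Fin P.d → ℤ))) := by
  rintro (⟨x, hx, hxz⟩ | ⟨x, hx, hxz⟩)
  · have hx' : x ∈ box n lo := hx
    have := castSite_inj_window hN (mem_window6 (c := 0) (c' := 0) (by norm_num) (by norm_num) (box_eq_shift ▸ hx'))
      (mem_window6 (c := 4) (c' := 2) (by norm_num) (by norm_num) hz) hxz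
    exact h1 (this ▸ hx')
  · have hx' : x ∈ box n lo := hx
    simp only [PBond.tgt] at hxz
    rw [← castSite_add_unitVec] at hxz
    have := castSite_inj_window hN (mem_window6 (c := 0) (c' := 0) (by norm_num) (by norm_num) (box_eq_shift ▸ hx'))
      (mem_window6 (c := 5) (c' := 2) (by norm_num) (by norm_num) (add_unitVec_mem μ hz)) hxz
    exact h2 (this ▸ hx')

variable {𝔤 : Type*} [NormedAddCommGroup 𝔤] [InnerProductSpace ℝ 𝔤]

/-- **`ιA B′` vanishes on the tree `G₀`** (the `x₁`-bonds `⟨castSite (x − e₁), e₁⟩`, `x ∈ Λ`): they are not free bonds.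
[cite: Balaban1989LargeFieldII, (1.8) p.358 («we put B′((x − e₁, x)) = 0 for x ∈ Λ»)] -/
theorem ιA_G0_eq_zero (h0 : 0 < P.d) {S : Set (Site P k)}
    (X : GaugeSlice S ((box n lo).image fun x => (⟨castSite (x - unitVec ⟨0, h0⟩), ⟨0, h0⟩⟩ : PBond P k)) 𝔤)
    {x : Fin P.d → ℤ} (hx : x ∈ box n lo) :
    ιA S _ X ⟨castSite (x - unitVec ⟨0, h0⟩), ⟨0, h0⟩⟩ = 0 :=
  ιA_apply_of_not_mem X fun h => (mem_freeBonds.1 h).2 (mem_image.2 ⟨x, hx, rfl⟩)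

end Window

/-! ## §2 (1.8) at the slice of record -/

section Slice

variable {lo : Fin P.d → ℤ} {n : Fin P.d → ℕ}

/-- `‖v‖² = Σ_a v_a²` on `ℝ³`. [folklore] -/
private theorem norm_sq_eq_sum (v : EuclideanSpace ℝ (Fin 3)) : ‖v‖ ^ 2 = ∑ a, v a ^ 2 := by
  rw [PiLp.norm_sq_eq_of_L2]
  simp [Real.norm_eq_abs, sq_abs]

/-- **(1.8) IN THE `x₁`-AXIAL GAUGE AT THE SLICE OF RECORD.**  `d ≥ 2`; `Λ^{(k)} = castSite″(box n lo)` with `n_κ + 5 < sitesPerDir k`;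
`G₀` = the `x₁`-bonds ending in `Λ^{(k)}`; `B′ : GaugeSlice (Λ^{(k)}) G₀ ℝ³`.  Then
`‖B′‖² ≤ (3K² + 2K⁴) · Σ_{z ∈ box (n+3)(lo−2)} Σ_μ Σ_a ((∂(ιA B′)_a)(castSite z; e₁, e_μ))²` for `n₁, n₂ ≤ K` — by
`B16Ineq18AxialGauge.ineq18_axial_vec` applied to the windowed pullback of `ιA B′` (supported on the bonds meeting `Λ`, zero on `G₀`),
whose left side dominates `‖B′‖²` (every free bond is `⟨castSite z, μ⟩` for a unique `z ∈ box (n+2)(lo−1)`) and whose right side is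
the displayed circulation sum (all evaluation points inside the window). [cite: Balaban1989LargeFieldII, (1.8) p.358] -/
theorem sliceNormSq_le (h0 : 0 < P.d) (h1 : 1 < P.d) (hN : ∀ κ, (n κ : ℤ) + 5 < P.sitesPerDir k) {K : ℕ}
    (hK0 : n ⟨0, h0⟩ ≤ K) (hK1 : n ⟨1, h1⟩ ≤ K) {S : Set (Site P k)} {T : Finset (PBond P k)}
    (hS : S = castSite '' (↑(box n lo) : Set (Fin P.d → ℤ)))
    (hT : T = (box n lo).image fun x => (⟨castSite (x - unitVec ⟨0, h0⟩), ⟨0, h0⟩⟩ : PBond P k))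
    (X : GaugeSlice S T (EuclideanSpace ℝ (Fin 3))) :
    ‖X‖ ^ 2 ≤ (3 * (K : ℝ) ^ 2 + 2 * (K : ℝ) ^ 4) *
      ∑ z ∈ box (fun i => n i + 3) (fun i => lo i - 2), ∑ μ : Fin P.d, ∑ a : Fin 3,
        curl (fun b => ιA S T X (⟨castSite b.1, b.2⟩ : PBond P k) a) z ⟨0, h0⟩ μ ^ 2 := by
  classical
  subst hS hT
  set A : VecField P k (EuclideanSpace ℝ (Fin 3)) :=
    ιA (castSite '' (↑(box n lo) : Set (Fin P.d → ℤ)))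
      ((box n lo).image fun x => (⟨castSite (x - unitVec ⟨0, h0⟩), ⟨0, h0⟩⟩ : PBond P k)) X with hA
  set W := box (fun i => n i + 4) (fun i => lo i - 2) with hW
  set E := box (fun i => n i + 2) (fun i => lo i - 1) with hE
  -- the windowed pullback
  set Bz : (Fin P.d → ℤ) × Fin P.d → (Fin 3 → ℝ) := fun b a => if b.1 ∈ W then A ⟨castSite b.1, b.2⟩ a else 0 with hBz
  have hBz_of_mem : ∀ {z : Fin P.d → ℤ} (μ : Fin P.d) (a : Fin 3), z ∈ W → Bz (z, μ) a = A ⟨castSite z, μ⟩ a :=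
    fun μ a hz => by simp only [hBz, if_pos hz]
  -- support: off the bonds meeting `Λ`
  have hAsupp : ∀ b : PBond P k, b ∉ bondsOf (castSite '' (↑(box n lo) : Set (Fin P.d → ℤ))) → A b = 0 := fun b hb =>
    ιA_apply_of_not_mem X fun h => hb (mem_freeBonds.1 h).1
  have hout : ∀ (z : Fin P.d → ℤ) (μ : Fin P.d), z ∉ box n lo → z + unitVec μ ∉ box n lo → Bz (z, μ) = 0 := by
    intro z μ hz1 hz2
    funext a
    by_cases hz : z ∈ W
    · rw [hBz_of_mem μ a hz, hAsupp _ (not_mem_bondsOf_of_window hN hz hz1 hz2)]; simp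
    · simp only [hBz, if_neg hz, Pi.zero_apply]
  -- the gauge
  have hax : ∀ x ∈ box n lo, Bz (x - unitVec ⟨0, h0⟩, ⟨0, h0⟩) = 0 := by
    intro x hx
    funext a
    have hxW : x - unitVec ⟨0, h0⟩ ∈ W := mem_box_mono (by norm_num) (by norm_num) (sub_unitVec_mem ⟨0, h0⟩ hx)
    rw [hBz_of_mem _ a hxW, hA, ιA_G0_eq_zero h0 X hx]; simp
  -- the `ℤ^d` theorem
  have hmain := ineq18_axial_vec h0 h1 Bz hax hout hK0 hK1
  -- (1) `‖X‖²` is dominated by the left side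
  have hLHS : ‖X‖ ^ 2 ≤ ∑ z ∈ E, ∑ μ : Fin P.d, ∑ a : Fin 3, Bz (z, μ) a ^ 2 := by
    -- `‖X‖² = Σ_{free b} ‖A b‖²`
    have hnorm : ‖X‖ ^ 2 = ∑ b ∈ freeBonds (castSite '' (↑(box n lo) : Set (Fin P.d → ℤ))) ((box n lo).image fun x => (⟨castSite (x - unitVec ⟨0, h0⟩), ⟨0, h0⟩⟩ : PBond P k)), ‖A b‖ ^ 2 := by
      rw [PiLp.norm_sq_eq_of_L2, ← sum_coe_sort (freeBonds (castSite '' (↑(box n lo) : Set (Fin P.d → ℤ))) ((box n lo).image fun x => (⟨castSite (x - unitVec ⟨0, h0⟩), ⟨0, h0⟩⟩ : PBond P k)))]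
      exact sum_congr rfl fun i _ => by rw [hA, ιA_apply_of_mem X i.2]
    rw [hnorm]
    -- every free bond is `⟨castSite z, μ⟩`, `z ∈ E`
    have hsub : freeBonds (castSite '' (↑(box n lo) : Set (Fin P.d → ℤ))) ((box n lo).image fun x => (⟨castSite (x - unitVec ⟨0, h0⟩), ⟨0, h0⟩⟩ : PBond P k)) ⊆
        (E ×ˢ (univ : Finset (Fin P.d))).image fun q => (⟨castSite q.1, q.2⟩ : PBond P k) := by
      intro b hb
      have hbS := (mem_freeBonds.1 hb).1
      rcases hbS with ⟨x, hx, hxb⟩ | ⟨x, hx, hxb⟩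
      · have hx' : x ∈ box n lo := hx
        refine mem_image.2 ⟨(x, b.dir), mem_product.2 ⟨?_, mem_univ _⟩, ?_⟩
        · exact mem_box_mono (by norm_num) (by norm_num) (box_eq_shift ▸ hx')
        · cases b; simp only at hxb; simp [hxb]
      · have hx' : x ∈ box n lo := hx
        refine mem_image.2 ⟨(x - unitVec b.dir, b.dir), mem_product.2 ⟨?_, mem_univ _⟩, ?_⟩
        · exact mem_box_mono (by norm_num) (by norm_num) (sub_unitVec_mem b.dir hx')
        · have hsrc : b.src = castSite (x - unitVec b.dir) :=
            shift_inj (by rw [shift_castSite_sub]; exact hxb.symm)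
          cases b; simp only at hsrc; simp [hsrc]
    have hinj : Set.InjOn (fun q : (Fin P.d → ℤ) × Fin P.d => (⟨castSite q.1, q.2⟩ : PBond P k))
        ↑(E ×ˢ (univ : Finset (Fin P.d))) := by
      rintro ⟨z, μ⟩ hz ⟨z', μ'⟩ hz' h
      simp only [PBond.mk.injEq] at h
      have hzE : z ∈ E := (mem_product.1 hz).1
      have hz'E : z' ∈ E := (mem_product.1 hz').1
      have := castSite_inj_window hN (mem_window6 (c := 2) (c' := 1) (by norm_num) (by norm_num) hzE)
        (mem_window6 (c := 2) (c' := 1) (by norm_num) (by norm_num) hz'E) h.1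
      rw [this, h.2]
    calc ∑ b ∈ freeBonds (castSite '' (↑(box n lo) : Set (Fin P.d → ℤ))) ((box n lo).image fun x => (⟨castSite (x - unitVec ⟨0, h0⟩), ⟨0, h0⟩⟩ : PBond P k)), ‖A b‖ ^ 2
        ≤ ∑ b ∈ (E ×ˢ (univ : Finset (Fin P.d))).image fun q => (⟨castSite q.1, q.2⟩ : PBond P k), ‖A b‖ ^ 2 :=
          sum_le_sum_of_subset_of_nonneg hsub fun _ _ _ => sq_nonneg _
      _ = ∑ q ∈ E ×ˢ (univ : Finset (Fin P.d)), ‖A ⟨castSite q.1, q.2⟩‖ ^ 2 := sum_image hinj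
      _ = ∑ z ∈ E, ∑ μ : Fin P.d, ‖A ⟨castSite z, μ⟩‖ ^ 2 := sum_product _ _ _
      _ = ∑ z ∈ E, ∑ μ : Fin P.d, ∑ a : Fin 3, Bz (z, μ) a ^ 2 := by
          refine sum_congr rfl fun z hz => sum_congr rfl fun μ _ => ?_
          rw [norm_sq_eq_sum]
          refine sum_congr rfl fun a _ => ?_
          rw [hBz_of_mem μ a (mem_box_mono (by norm_num) (by norm_num) hz)]
  -- (2) the right side is the displayed circulation sum (all points inside the window)
  have hRHS : ∑ z ∈ box (fun i => n i + 3) (fun i => lo i - 2), ∑ μ : Fin P.d, ∑ a : Fin 3,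
      curl (fun b => Bz b a) z ⟨0, h0⟩ μ ^ 2 =
      ∑ z ∈ box (fun i => n i + 3) (fun i => lo i - 2), ∑ μ : Fin P.d, ∑ a : Fin 3,
        curl (fun b => A ⟨castSite b.1, b.2⟩ a) z ⟨0, h0⟩ μ ^ 2 := by
    refine sum_congr rfl fun z hz => sum_congr rfl fun μ _ => sum_congr rfl fun a _ => ?_
    have hzW : z ∈ W := mem_box_mono (by norm_num) (by norm_num) hz
    have h0W : z + unitVec ⟨0, h0⟩ ∈ W := add_unitVec_mem _ hz
    have hμW : z + unitVec μ ∈ W := add_unitVec_mem _ hz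
    simp only [curl, hBz_of_mem _ a hzW, hBz_of_mem _ a h0W, hBz_of_mem _ a hμW]
  rw [hRHS, ← hE] at hmain
  exact hLHS.trans hmain

/-- **(1.9) AT THE SLICE OF RECORD FROM THE (1.7) LETTER** ([LF-II] p. 358: *«The inequalities (1.7), (1.8) imply finally
⟨H_{1,k}B′, Δ₁(ζ₀)H_{1,k}B′⟩ ≧ γ₀/(2d(100M)⁵)‖B′‖², (1.9) for g_k sufficiently small»*).  With `Q(B′)` the circulation sum of
`sliceNormSq_le` (the typed `‖∂B′‖²`), `c_P = 3K² + 2K⁴` its constant: if (1.7) holds in the form `γ₀·Q(B′) − C_err·‖B′‖² ≤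
⟨HB′, Δ₁HB′⟩` (the p. 357 perturbation letter, HYPOTHESIS `h17`) and *«g_k sufficiently small»* reads `C_err ≤ γ₀/(2c_P)`, then
`γ₀/(2c_P)·‖B′‖² ≤ ⟨HB′, Δ₁HB′⟩` for every `B′` of the slice — the positivity letter (m1) of `prop1Printed_lfVarOn_su2_box_slice` at this
slice, modulo (1.7). [cite: Balaban1989LargeFieldII, (1.7)–(1.9) p.358] -/
theorem ineq19_slice_of_17 (h0 : 0 < P.d) (h1 : 1 < P.d) (hN : ∀ κ, (n κ : ℤ) + 5 < P.sitesPerDir k) {K : ℕ} (hK : 1 ≤ K)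
    (hK0 : n ⟨0, h0⟩ ≤ K) (hK1 : n ⟨1, h1⟩ ≤ K) {S : Set (Site P k)} {T : Finset (PBond P k)}
    (hS : S = castSite '' (↑(box n lo) : Set (Fin P.d → ℤ)))
    (hT : T = (box n lo).image fun x => (⟨castSite (x - unitVec ⟨0, h0⟩), ⟨0, h0⟩⟩ : PBond P k))
    {F : Type*} [NormedAddCommGroup F] [InnerProductSpace ℝ F]
    (H : GaugeSlice S T (EuclideanSpace ℝ (Fin 3)) →ₗ[ℝ] F) (Δ₁ : F →ₗ[ℝ] F) {γ₀ Cerr : ℝ} (hγ₀ : 0 ≤ γ₀)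
    (h17 : ∀ X : GaugeSlice S T (EuclideanSpace ℝ (Fin 3)),
      γ₀ * (∑ z ∈ box (fun i => n i + 3) (fun i => lo i - 2), ∑ μ : Fin P.d, ∑ a : Fin 3,
          curl (fun b => ιA S T X (⟨castSite b.1, b.2⟩ : PBond P k) a) z ⟨0, h0⟩ μ ^ 2) - Cerr * ‖X‖ ^ 2 ≤
        inner ℝ (H X) (Δ₁ (H X)))
    (hsm : Cerr ≤ γ₀ / (2 * (3 * (K : ℝ) ^ 2 + 2 * (K : ℝ) ^ 4))) (X : GaugeSlice S T (EuclideanSpace ℝ (Fin 3))) :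
    γ₀ / (2 * (3 * (K : ℝ) ^ 2 + 2 * (K : ℝ) ^ 4)) * ‖X‖ ^ 2 ≤ inner ℝ (H X) (Δ₁ (H X)) := by
  set cP : ℝ := 3 * (K : ℝ) ^ 2 + 2 * (K : ℝ) ^ 4 with hcP
  set Q : ℝ := ∑ z ∈ box (fun i => n i + 3) (fun i => lo i - 2), ∑ μ : Fin P.d, ∑ a : Fin 3,
    curl (fun b => ιA S T X (⟨castSite b.1, b.2⟩ : PBond P k) a) z ⟨0, h0⟩ μ ^ 2 with hQ
  have hK' : (1 : ℝ) ≤ K := by exact_mod_cast hK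
  have hcP0 : 0 < cP := by rw [hcP]; positivity
  have h18 : ‖X‖ ^ 2 ≤ cP * Q := sliceNormSq_le h0 h1 hN hK0 hK1 hS hT X
  have hX : 0 ≤ ‖X‖ ^ 2 := sq_nonneg _
  -- `γ₀ Q ≥ (γ₀/cP)‖X‖²`
  have hQ' : γ₀ / cP * ‖X‖ ^ 2 ≤ γ₀ * Q := by
    rw [div_mul_eq_mul_div, div_le_iff₀ hcP0]
    calc γ₀ * ‖X‖ ^ 2 ≤ γ₀ * (cP * Q) := mul_le_mul_of_nonneg_left h18 hγ₀
      _ = γ₀ * Q * cP := by ring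
  have h := h17 X
  have hhalf : γ₀ / (2 * cP) * ‖X‖ ^ 2 = γ₀ / cP * ‖X‖ ^ 2 - γ₀ / (2 * cP) * ‖X‖ ^ 2 := by
    field_simp
    ring
  rw [hhalf]
  have hsm' : Cerr * ‖X‖ ^ 2 ≤ γ₀ / (2 * cP) * ‖X‖ ^ 2 := mul_le_mul_of_nonneg_right hsm hX
  linarith

end Slice

end Literature.MathematicalPhysics.QuantumFieldTheory.Balaban1983to89.B15Prop1SliceIneq18

end
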